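import Literature.MathematicalPhysics.KineticTheory.TaggedSphereGainCompact
import Literature.MathematicalPhysics.KineticTheory.TaggedSphereDiffusionProofs
import Mathlib.Analysis.Normed.Operator.Compact.FredholmAlternative
import HarnessLib

/-!
# BGSR Lemma 6.1: the diffusion corrector `b = L⁻¹ v` exists and is unique
(Bodineau–Gallagher–Saint-Raymond, Invent. Math. 203 (2016) = arXiv:1305.3397v2, §6.1.2,
Lemma 6.1 and (6.5); discharge of the named fact
`Literature.MathematicalPhysics.KineticTheory.bgsr_exists_diffusionCorrector` of `TaggedSphereDiffusion`)

BGSR Lemma 6.1: "The operator `L` is a Fredholm operator of domain `L²(ℝ^d, a_β M_β dv)` and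
its kernel reduces to the constant functions. In particular, `L` is invertible on the set of
functions `{g ∈ L²(a_β M_β), ∫ g M_β = 0}`" — whence the corrector `b` of (6.5), `L b = v`,
`∫ b M_β = 0`. We prove the named fact `bgsr_exists_diffusionCorrector` (existence and a.e.
uniqueness of a centred `b ∈ L²(a_β M_β)` with `L bᵢ = vᵢ` a.e.) as follows, with
`T = a_β⁻¹ K` the compact gain operator on `H = L²(a_β M_β)` of `TaggedSphereGainCompact`
(`L = a_β (Id - T)`):

1. *Conservation* `⟪T g, 1⟫_H = ⟪g, 1⟫_H` (`inner_gainOp_constOne`; the gain-side marginal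
   `∫∫ M_β k_β g(v + u) = ∫ a_β M_β g`).
2. *Kernel* (`exists_const_of_gainOp_apply_eq`): `‖g‖² - ⟪T g, g⟫ = ½ ∫∫ M_β k_β (g(v) - g(v + u))²`
   and `k_β > 0` off `u = 0`, so `T g = g` forces `g(v) = g(v + u)` a.e., i.e. `g` is a.e. constant
   (Fubini): `ker(Id - T) = ℝ 1`, the printed kernel statement.
3. *Fredholm alternative* (Mathlib's `IsCompactOperator.hasEigenvalue_or_mem_resolventSet`)
   applied to the compact operator `T' = T - P`, `P` the rank-one projection onto `ℝ 1`: by 1–2,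
   `1` is not an eigenvalue of `T'`, so `Id - T'` is invertible, and for `F ⊥ 1` the solution of
   `g - T' g = F` satisfies `P g = 0`, i.e. `g - T g = F` (`exists_sub_gainOp_eq`).
4. *The corrector*: `Fᵢ = vᵢ / a_β ∈ H` is `⊥ 1` (`∫ vᵢ M_β = 0`), so `gᵢ - T gᵢ = Fᵢ`; testing against
   indicators, `a_β gᵢ - K gᵢ = vᵢ` a.e., i.e. `L gᵢ = vᵢ` a.e. (`L = a - K⁺`, `K⁺ = K` on
   `L²(a_β M_β)`, `TaggedSphereCarleman`); centring `bᵢ = gᵢ - ∫ gᵢ M_β` keeps this (`L 1 = 0`).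
5. *Uniqueness*: the difference of two correctors is, componentwise, a centred element of
   `ker(Id - T)`, hence `0` a.e.

## Main results

* `exists_centred_solution` — `L` is invertible on the centred functions for right-hand sides
  `a_β F ⊥ 1`, `F ∈ L²(a_β M_β)` (the printed invertibility statement of Lemma 6.1).
* `exists_isDiffusionCorrector`, `isDiffusionCorrector_unique`,
  `bgsr_exists_diffusionCorrector_holds : bgsr_exists_diffusionCorrector` — (6.5).
* `exists_secondCorrector` — (6.7): the centred matrix corrector `D` with
  `L D = v ⊗ b - ∫ v ⊗ b M_β` exists, entrywise (its right-hand side is `a_β F` with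
  `F ∈ L²(a_β M_β)` because `a_β(v) ≥ c |v|`).

## References

* T. Bodineau, I. Gallagher, L. Saint-Raymond, *The Brownian motion as the limit of a
  deterministic system of hard-spheres*, Invent. Math. 203 (2016) 493–553 = arXiv:1305.3397v2,
  §6.1.2: Lemma 6.1, (6.5), (6.7).
* D. Hilbert, *Begründung der kinetischen Gastheorie*, Math. Ann. 72 (1912) (BGSR's [24]).
* C. Cercignani, R. Illner, M. Pulvirenti, *The Mathematical Theory of Dilute Gases* (1994), §7.2.
-/

open MeasureTheory Metric Set Filter Topology ProbabilityTheory
open scoped InnerProductSpace ENNReal NNReal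

noncomputable section

namespace Literature.MathematicalPhysics.KineticTheory

open Literature.Analysis.FunctionSpaces (maxwellianBeta maxwellianBeta_pos)
open TaggedSphereDiffusion (collisionFrequency)

variable {d : Type*} [Fintype d] {β : ℝ}

/-! ## Constants in `L²(a_β M_β)` and conservation `⟪T g, 1⟫ = ⟪g, 1⟫` -/

section Const

variable (hd : 2 ≤ Fintype.card d) (hβ : 0 < β)

include hβ in
/-- `a_β M_β` is integrable. [folklore] -/
theorem integrable_collisionFrequency_mul_maxwellianBeta :
    Integrable fun v : EuclideanSpace ℝ d => collisionFrequency β v * maxwellianBeta β v := by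
  refine ⟨(measurable_collisionFrequency_mul_maxwellianBeta hβ).aestronglyMeasurable, ?_⟩
  refine lt_of_le_of_lt (le_of_eq (lintegral_congr fun v => ?_))
    (lintegral_collisionFrequency_mul_maxwellianBeta_lt_top (d := d) hβ)
  rw [Real.enorm_of_nonneg (mul_nonneg (TaggedLinearBoltzmannSeries.collisionFrequency_nonneg hβ v)
    (maxwellianBeta_pos hβ v).le)]

include hβ in
/-- Constants have finite energy. [folklore] -/
theorem finiteEnergy_const (c : ℝ) : FiniteEnergy β (fun _ : EuclideanSpace ℝ d => c) :=
  ⟨measurable_const, ((integrable_collisionFrequency_mul_maxwellianBeta hβ).const_mul (c ^ 2)).congr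
    (Eventually.of_forall fun v => by ring)⟩

include hβ in
/-- Constants lie in `L²(a_β M_β)`. [folklore] -/
theorem memLp_const_energyMeasure (c : ℝ) : MemLp (fun _ : EuclideanSpace ℝ d => c) 2 (energyMeasure (d := d) β) := by
  haveI := isFiniteMeasure_energyMeasure (d := d) hβ
  exact memLp_const c

/-- **The constant function `1 ∈ L²(a_β M_β)`.** [folklore] -/
def constOne : Lp ℝ 2 (energyMeasure (d := d) β) := (memLp_const_energyMeasure hβ 1).toLp _

include hd in
/-- `rep 1 = 1` a.e. [folklore] -/
theorem rep_constOne : rep (constOne (d := d) hβ) =ᵐ[volume] fun _ => 1 :=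
  rep_toLp_ae_eq hd hβ _

include hd in
/-- `⟪g, 1⟫ = ∫ g a_β M_β`. [folklore] -/
theorem inner_constOne (g : Lp ℝ 2 (energyMeasure (d := d) β)) :
    ⟪g, constOne hβ⟫_ℝ = ∫ v, rep g v * (collisionFrequency β v * maxwellianBeta β v) := by
  rw [inner_eq_integral_rep hβ]
  refine integral_congr_ae ?_
  filter_upwards [rep_constOne hd hβ] with v hv
  rw [hv, mul_one]

include hd in
/-- `⟪1, g⟫ = ∫ g a_β M_β`. [folklore] -/
theorem inner_constOne_left (g : Lp ℝ 2 (energyMeasure (d := d) β)) :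
    ⟪constOne hβ, g⟫_ℝ = ∫ v, rep g v * (collisionFrequency β v * maxwellianBeta β v) := by
  rw [real_inner_comm, inner_constOne hd hβ]

include hd in
/-- `⟪1, 1⟫ = ∫ a_β M_β > 0`. [folklore] -/
theorem inner_constOne_constOne_pos : 0 < ⟪constOne (d := d) hβ, constOne hβ⟫_ℝ := by
  rw [inner_constOne hd hβ]
  have h : ∫ v, rep (constOne (d := d) hβ) v * (collisionFrequency β v * maxwellianBeta β v) =
      ∫ v : EuclideanSpace ℝ d, collisionFrequency β v * maxwellianBeta β v := by
    refine integral_congr_ae ?_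
    filter_upwards [rep_constOne hd hβ] with v hv
    rw [hv, one_mul]
  rw [h, integral_pos_iff_support_of_nonneg (fun v => (collisionFrequency_mul_maxwellianBeta_pos hd hβ v).le)
    (integrable_collisionFrequency_mul_maxwellianBeta hβ)]
  have hsupp : Function.support (fun v : EuclideanSpace ℝ d => collisionFrequency β v * maxwellianBeta β v) = univ := by
    ext v
    simp only [Function.mem_support, ne_eq, mem_univ, iff_true]
    exact (collisionFrequency_mul_maxwellianBeta_pos hd hβ v).ne'
  rw [hsupp]
  exact lt_of_lt_of_le (measure_ball_pos volume (0 : EuclideanSpace ℝ d) one_pos) (measure_mono (subset_univ _))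

include hd hβ in
/-- `∫ k_β(v, u) du = a_β(v)` (real form of `lintegral_carlemanKernel`). [folklore] -/
theorem integral_carlemanKernel (v : EuclideanSpace ℝ d) :
    ∫ u, carlemanKernel β v u = collisionFrequency β v := by
  rw [integral_eq_lintegral_of_nonneg_ae (Eventually.of_forall fun u => carlemanKernel_nonneg β v u)
    (measurable_carlemanKernel_right β v).aestronglyMeasurable, lintegral_carlemanKernel hd hβ v,
    ENNReal.toReal_ofReal (TaggedLinearBoltzmannSeries.collisionFrequency_nonneg hβ v)]

include hd hβ in
/-- `u ↦ k_β(v, u)` is integrable. [folklore] -/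
theorem integrable_carlemanKernel (v : EuclideanSpace ℝ d) : Integrable (carlemanKernel β v) := by
  refine ⟨(measurable_carlemanKernel_right β v).aestronglyMeasurable, ?_⟩
  have h : ∫⁻ u, ‖carlemanKernel β v u‖ₑ = ∫⁻ u, ENNReal.ofReal (carlemanKernel β v u) :=
    lintegral_congr fun u => by rw [Real.enorm_of_nonneg (carlemanKernel_nonneg β v u)]
  show ∫⁻ u, ‖carlemanKernel β v u‖ₑ < ∞
  rw [h, lintegral_carlemanKernel hd hβ v]
  exact ENNReal.ofReal_lt_top

include hd hβ in
/-- `K 1 = a_β`: `carlemanGain β 1 v = a_β(v)`. [folklore] -/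
theorem carlemanGain_const (c : ℝ) (v : EuclideanSpace ℝ d) :
    carlemanGain β (fun _ => c) v = c * collisionFrequency β v := by
  rw [carlemanGain, ← integral_carlemanKernel hd hβ v, ← integral_const_mul]
  refine integral_congr_ae (Eventually.of_forall fun u => ?_)
  show carlemanKernel β v u * c = c * carlemanKernel β v u
  ring

include hd hβ in
/-- **The gain-side marginal**: `⟨K g, 1⟩_{L²(M)} = ∫ g a_β M_β`. [folklore] -/
theorem carlemanForm_one_right {g : EuclideanSpace ℝ d → ℝ} (hg : FiniteEnergy β g) :
    carlemanForm β g (fun _ => 1) = ∫ v, g v * (collisionFrequency β v * maxwellianBeta β v) := by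
  have h1 := finiteEnergy_const (d := d) hβ 1
  rw [carlemanForm_comm hβ, carlemanForm_eq_integral_carlemanGain hd hβ h1.measurable h1.integrable
    hg.measurable hg.integrable]
  refine integral_congr_ae (Eventually.of_forall fun v => ?_)
  simp only
  rw [carlemanGain_const hd hβ]
  ring

/-- **Conservation: `⟪T g, 1⟫ = ⟪g, 1⟫`** (the background carries no net mass exchange;
`∫ (K g) M_β = ∫ a_β g M_β`). [folklore] -/
theorem inner_gainOp_constOne (g : Lp ℝ 2 (energyMeasure (d := d) β)) :
    ⟪gainOp hd hβ g, constOne hβ⟫_ℝ = ⟪g, constOne hβ⟫_ℝ := by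
  rw [inner_gainOp, ← truncForm_one, truncForm_congr_ae β _ EventuallyEq.rfl (rep_constOne hd hβ),
    truncForm_one, carlemanForm_one_right hd hβ (finiteEnergy_rep hβ g), inner_constOne hd hβ]

end Const

/-! ## The kernel of `Id - T` is the constants -/

section Kernel

variable (hd : 2 ≤ Fintype.card d) (hβ : 0 < β)

include hβ in
/-- The Carleman kernel is positive away from `u = 0`. [folklore] -/
theorem carlemanKernel_pos' (v : EuclideanSpace ℝ d) {u : EuclideanSpace ℝ d} (hu : u ≠ 0) :
    0 < carlemanKernel β v u := by
  have hnu : 0 < ‖u‖ := norm_pos_iff.2 hu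
  have hvpos : (β⁻¹).toNNReal ≠ 0 := by
    simpa [Real.toNNReal_eq_zero, not_le] using inv_pos.2 hβ
  unfold carlemanKernel
  exact mul_pos (inv_pos.2 (pow_pos hnu _)) (gaussianPDFReal_pos _ _ _ hvpos)

include hd hβ in
/-- **The Dirichlet form of `Id - T`**:
`2 (‖g‖² - ⟪T g, g⟫) = ∫∫ M_β(v) k_β(v, u) (g(v) - g(v + u))² du dv`. [folklore] -/
theorem two_mul_norm_sq_sub_inner_gainOp (g : Lp ℝ 2 (energyMeasure (d := d) β)) :
    2 * (‖g‖ ^ 2 - ⟪gainOp hd hβ g, g⟫_ℝ) =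
      ∫ z, maxwellianBeta β z.1 * carlemanKernel β z.1 z.2 * (rep g z.1 - rep g (z.1 + z.2)) ^ 2
        ∂((volume : Measure (EuclideanSpace ℝ d)).prod volume) := by
  have hg := finiteEnergy_rep hβ g
  obtain ⟨hA, hAv⟩ := integrable_weight_mul_sq_shift hd hβ hg.measurable hg.integrable
  obtain ⟨hB, hBv⟩ := integrable_weight_mul_sq hd hβ hg.measurable hg.integrable
  have hC := integrable_weight_mul_mul hd hβ hg.measurable hg.integrable hg.measurable hg.integrable
  rw [norm_sq_eq_integral_rep hβ, inner_gainOp, carlemanForm]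
  have hsplit : ∀ z : EuclideanSpace ℝ d × EuclideanSpace ℝ d,
      maxwellianBeta β z.1 * carlemanKernel β z.1 z.2 * (rep g z.1 - rep g (z.1 + z.2)) ^ 2 =
      (maxwellianBeta β z.1 * carlemanKernel β z.1 z.2 * rep g z.1 ^ 2 +
        maxwellianBeta β z.1 * carlemanKernel β z.1 z.2 * rep g (z.1 + z.2) ^ 2) -
        2 * (maxwellianBeta β z.1 * carlemanKernel β z.1 z.2 * (rep g (z.1 + z.2) * rep g z.1)) :=
    fun z => by ring
  have hBA : Integrable (fun z : EuclideanSpace ℝ d × EuclideanSpace ℝ d =>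
      maxwellianBeta β z.1 * carlemanKernel β z.1 z.2 * rep g z.1 ^ 2 +
        maxwellianBeta β z.1 * carlemanKernel β z.1 z.2 * rep g (z.1 + z.2) ^ 2)
      ((volume : Measure (EuclideanSpace ℝ d)).prod volume) := hB.add hA
  have hC2 : Integrable (fun z : EuclideanSpace ℝ d × EuclideanSpace ℝ d =>
      2 * (maxwellianBeta β z.1 * carlemanKernel β z.1 z.2 * (rep g (z.1 + z.2) * rep g z.1)))
      ((volume : Measure (EuclideanSpace ℝ d)).prod volume) := hC.const_mul 2
  rw [integral_congr_ae (Eventually.of_forall hsplit), integral_sub hBA hC2, integral_add hB hA,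
    integral_const_mul, hAv, hBv]
  ring

include hd hβ in
/-- **`ker(Id - T)` is the constants** (BGSR Lemma 6.1: "its kernel reduces to the constant
functions"): if `T g = g` then `g` is a.e. constant.
[cite: BodineauGallagherSaintRaymondInvent2016, Lemma 6.1] -/
theorem exists_const_of_gainOp_apply_eq {g : Lp ℝ 2 (energyMeasure (d := d) β)} (h : gainOp hd hβ g = g) :
    ∃ c : ℝ, rep g =ᵐ[volume] fun _ => c := by
  haveI : Nonempty d := Fintype.card_pos_iff.1 (by omega)
  have hg := finiteEnergy_rep hβ g
  -- the Dirichlet form vanishes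
  have h0 : ∫ z, maxwellianBeta β z.1 * carlemanKernel β z.1 z.2 * (rep g z.1 - rep g (z.1 + z.2)) ^ 2
      ∂((volume : Measure (EuclideanSpace ℝ d)).prod volume) = 0 := by
    rw [← two_mul_norm_sq_sub_inner_gainOp hd hβ g, h, real_inner_self_eq_norm_sq, sub_self, mul_zero]
  have hnn : ∀ z : EuclideanSpace ℝ d × EuclideanSpace ℝ d,
      0 ≤ maxwellianBeta β z.1 * carlemanKernel β z.1 z.2 * (rep g z.1 - rep g (z.1 + z.2)) ^ 2 :=
    fun z => mul_nonneg (carlemanWeight_nonneg hβ z) (sq_nonneg _)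
  have hint : Integrable (fun z : EuclideanSpace ℝ d × EuclideanSpace ℝ d =>
      maxwellianBeta β z.1 * carlemanKernel β z.1 z.2 * (rep g z.1 - rep g (z.1 + z.2)) ^ 2)
      ((volume : Measure (EuclideanSpace ℝ d)).prod volume) := by
    obtain ⟨hA, -⟩ := integrable_weight_mul_sq_shift hd hβ hg.measurable hg.integrable
    obtain ⟨hB, -⟩ := integrable_weight_mul_sq hd hβ hg.measurable hg.integrable
    have hC := integrable_weight_mul_mul hd hβ hg.measurable hg.integrable hg.measurable hg.integrable
    exact ((hB.add hA).sub (hC.const_mul 2)).congr (Eventually.of_forall fun z => by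
      simp only [Pi.add_apply, Pi.sub_apply]; ring)
  have hae := (integral_eq_zero_iff_of_nonneg hnn hint).1 h0
  -- hence `g(v) = g(v + u)` for a.e. `(v, u)`
  have hae' : ∀ᵐ z : EuclideanSpace ℝ d × EuclideanSpace ℝ d ∂(volume.prod volume),
      rep g z.1 = rep g (z.1 + z.2) := by
    have hnull : ∀ᵐ z : EuclideanSpace ℝ d × EuclideanSpace ℝ d ∂(volume.prod volume), z.2 ≠ 0 := by
      have : (volume.prod volume) {z : EuclideanSpace ℝ d × EuclideanSpace ℝ d | z.2 = 0} = 0 := by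
        have hset : {z : EuclideanSpace ℝ d × EuclideanSpace ℝ d | z.2 = 0} = univ ×ˢ {0} := by
          ext z; simp
        rw [hset, Measure.prod_prod, measure_singleton, mul_zero]
      rw [ae_iff]
      simpa using this
    filter_upwards [hae, hnull] with z hz hz2
    simp only [Pi.zero_apply, mul_eq_zero] at hz
    rcases hz with (hM | hk) | hsub
    · exact absurd hM (maxwellianBeta_pos hβ z.1).ne'
    · exact absurd hk (carlemanKernel_pos' hβ z.1 hz2).ne'
    · exact sub_eq_zero.1 ((pow_eq_zero_iff two_ne_zero).1 hsub)
  -- in the variables `(v, w) = (v, v + u)`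
  have hae'' : ∀ᵐ z : EuclideanSpace ℝ d × EuclideanSpace ℝ d ∂(volume.prod volume), rep g z.1 = rep g z.2 := by
    have hmp := measurePreserving_prod_add_euclidean (d := d)
    have hmeas : MeasurableSet {z : EuclideanSpace ℝ d × EuclideanSpace ℝ d | ¬ rep g z.1 = rep g z.2} :=
      (measurableSet_eq_fun (hg.measurable.comp measurable_fst) (hg.measurable.comp measurable_snd)).compl
    rw [ae_iff] at hae' ⊢
    have hpre := hmp.measure_preimage hmeas.nullMeasurableSet
    rw [← hpre]
    simpa using hae'
  -- Fubini: pick a good `v₀`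
  have hfub := Measure.ae_ae_of_ae_prod hae''
  haveI : (ae (volume : Measure (EuclideanSpace ℝ d))).NeBot := ae_neBot.2 (NeZero.ne _)
  obtain ⟨v₀, hv₀⟩ := hfub.exists
  exact ⟨rep g v₀, by filter_upwards [hv₀] with w hw; exact hw.symm⟩

include hd in
/-- An element of `L²(a_β M_β)` with a.e. constant representative is a multiple of `1`.
[folklore] -/
theorem eq_smul_constOne_of_rep_ae_const {g : Lp ℝ 2 (energyMeasure (d := d) β)} {c : ℝ}
    (h : rep g =ᵐ[volume] fun _ => c) : g = c • constOne hβ := by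
  refine Lp.ext ?_
  replace h : ∀ᵐ v ∂energyMeasure β, rep g v = c := (energyMeasure_absolutelyContinuous β).ae_le h
  have h1 := rep_ae_eq g
  have h2 : rep (constOne (d := d) hβ) =ᵐ[energyMeasure β] fun _ => 1 :=
    (ae_energyMeasure_iff hd hβ).2 (rep_constOne hd hβ)
  have h3 := rep_ae_eq (constOne (d := d) hβ)
  filter_upwards [h, h1, h2, h3, Lp.coeFn_smul c (constOne (d := d) hβ)] with v hv hv1 hv2 hv3 hv4
  rw [hv4, Pi.smul_apply, ← hv3, hv2, ← hv1, hv, smul_eq_mul, mul_one]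

end Kernel

/-! ## The Fredholm alternative for `T' = T - P` -/

section Fredholm

variable (hd : 2 ≤ Fintype.card d) (hβ : 0 < β)

/-- The rank-one projection onto the constants, `P g = ⟪1, g⟫ / ⟪1, 1⟫ · 1`. [folklore] -/
def projConst : Lp ℝ 2 (energyMeasure (d := d) β) →L[ℝ] Lp ℝ 2 (energyMeasure (d := d) β) :=
  (innerSL ℝ (constOne hβ)).smulRight ((⟪constOne (d := d) hβ, constOne hβ⟫_ℝ)⁻¹ • constOne hβ)

/-- Evaluation of `P`. [folklore] -/
theorem projConst_apply (g : Lp ℝ 2 (energyMeasure (d := d) β)) :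
    projConst hβ g = ⟪constOne hβ, g⟫_ℝ • ((⟪constOne (d := d) hβ, constOne hβ⟫_ℝ)⁻¹ • constOne hβ) := by
  simp [projConst, ContinuousLinearMap.smulRight_apply, innerSL_apply_apply]

include hd in
/-- `⟪P g, 1⟫ = ⟪1, g⟫`. [folklore] -/
theorem inner_projConst_constOne (g : Lp ℝ 2 (energyMeasure (d := d) β)) :
    ⟪projConst hβ g, constOne hβ⟫_ℝ = ⟪constOne hβ, g⟫_ℝ := by
  have hne := (inner_constOne_constOne_pos hd hβ).ne'
  rw [projConst_apply, inner_smul_left, inner_smul_left]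
  simp only [conj_trivial]
  field_simp

/-- `P` is compact (rank one). [folklore] -/
theorem isCompactOperator_projConst : IsCompactOperator (projConst (d := d) hβ) :=
  Literature.Analysis.FunctionSpaces.isCompactOperator_smulRight _ _

/-- **`1` is not an eigenvalue of `T' = T - P`.** If `T g - P g = g`, pairing with `1` and using
conservation gives `⟪1, g⟫ = 0`, so `P g = 0`, `T g = g`, `g` is constant, and then `g = 0`.
[folklore] -/
theorem not_hasEigenvalue_one :
    ¬ Module.End.HasEigenvalue ((gainOp hd hβ - projConst hβ :
      Lp ℝ 2 (energyMeasure (d := d) β) →L[ℝ] Lp ℝ 2 (energyMeasure (d := d) β)) :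
        Module.End ℝ (Lp ℝ 2 (energyMeasure (d := d) β))) 1 := by
  intro hev
  obtain ⟨g, hg⟩ := hev.exists_hasEigenvector
  have happ : gainOp hd hβ g - projConst hβ g = g := by
    have h := hg.apply_eq_smul
    simpa using h
  have hne : g ≠ 0 := hg.2
  -- `⟪1, g⟫ = 0`
  have hinner : ⟪constOne hβ, g⟫_ℝ = 0 := by
    have h := congrArg (fun x => ⟪x, constOne hβ⟫_ℝ) happ
    simp only [inner_sub_left, inner_gainOp_constOne hd hβ, inner_projConst_constOne hd hβ] at h
    linarith
  have hP : projConst hβ g = 0 := by rw [projConst_apply, hinner, zero_smul]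
  rw [hP, sub_zero] at happ
  obtain ⟨c, hc⟩ := exists_const_of_gainOp_apply_eq hd hβ happ
  have hgc := eq_smul_constOne_of_rep_ae_const hd hβ hc
  rw [hgc, inner_smul_right] at hinner
  rcases mul_eq_zero.1 hinner with h0 | h0
  · rw [h0, zero_smul] at hgc; exact hne hgc
  · exact absurd h0 (inner_constOne_constOne_pos hd hβ).ne'

/-- **Solvability of `g - T g = F` for `F ⊥ 1`** (the Fredholm alternative for the compact
operator `T - P`, Mathlib's `IsCompactOperator.hasEigenvalue_or_mem_resolventSet`).
[cite: BodineauGallagherSaintRaymondInvent2016, Lemma 6.1] -/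
theorem exists_sub_gainOp_eq (F : Lp ℝ 2 (energyMeasure (d := d) β)) (hF : ⟪constOne hβ, F⟫_ℝ = 0) :
    ∃ g : Lp ℝ 2 (energyMeasure (d := d) β), g - gainOp hd hβ g = F := by
  set T' := gainOp hd hβ - projConst hβ with hT'
  have hcomp : IsCompactOperator T' := (isCompactOperator_gainOp hd hβ).sub (isCompactOperator_projConst hβ)
  have hres := (IsCompactOperator.hasEigenvalue_or_mem_resolventSet hcomp one_ne_zero).resolve_left
    (not_hasEigenvalue_one hd hβ)
  rw [spectrum.mem_resolventSet_iff, ContinuousLinearMap.isUnit_iff_bijective] at hres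
  obtain ⟨g, hg⟩ := hres.2 F
  have hg' : g - T' g = F := by
    have h1 : (algebraMap ℝ (Lp ℝ 2 (energyMeasure (d := d) β) →L[ℝ] Lp ℝ 2 (energyMeasure (d := d) β)) 1 - T') g =
        g - T' g := by
      rw [Algebra.algebraMap_eq_smul_one, one_smul]
      rfl
    rw [← h1]
    exact hg
  -- `P g = 0`
  have hinner : ⟪constOne hβ, g⟫_ℝ = 0 := by
    have h := congrArg (fun x => ⟪x, constOne hβ⟫_ℝ) hg'
    simp only [hT', _root_.sub_apply, inner_sub_left, inner_gainOp_constOne hd hβ,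
      inner_projConst_constOne hd hβ] at h
    rw [real_inner_comm (constOne hβ) F, hF] at h
    linarith
  have hP : projConst hβ g = 0 := by rw [projConst_apply, hinner, zero_smul]
  refine ⟨g, ?_⟩
  rw [hT', _root_.sub_apply, hP, sub_zero] at hg'
  exact hg'

end Fredholm

/-! ## Solving `L gᵢ = vᵢ` -/

section Solve

variable (hd : 2 ≤ Fintype.card d) (hβ : 0 < β) (i : d)

include hβ in
/-- The coordinate `vᵢ` has finite energy. [folklore] -/
theorem finiteEnergy_coord : FiniteEnergy β (fun v : EuclideanSpace ℝ d => v i) :=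
  ⟨(EuclideanSpace.proj (𝕜 := ℝ) i).continuous.measurable, integrable_sq_apply_mul_collisionFrequency_mul hβ i⟩

include hd hβ in
/-- The right-hand side `Fᵢ = vᵢ / a_β` lies in `L²(a_β M_β)`. [folklore] -/
theorem memLp_coord_div : MemLp (fun v : EuclideanSpace ℝ d => v i / collisionFrequency β v) 2 (energyMeasure (d := d) β) := by
  obtain ⟨a₀, ha₀, c, hc, hlow⟩ := exists_collisionFrequency_lowerBound (d := d) hd hβ
  have ha : ∀ w : EuclideanSpace ℝ d, 0 < collisionFrequency β w := fun w => ha₀.trans_le (hlow w).1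
  have hcont : Continuous fun v : EuclideanSpace ℝ d => v i / collisionFrequency β v :=
    (EuclideanSpace.proj (𝕜 := ℝ) i).continuous.div (continuous_collisionFrequency hβ) fun v => (ha v).ne'
  rw [memLp_two_iff_integrable_sq hcont.aestronglyMeasurable, integrable_energyMeasure_iff hβ]
  refine ((integrable_sq_apply_mul_maxwellianBeta hβ i).div_const a₀).mono'
    ((hcont.pow 2).mul ((continuous_collisionFrequency hβ).mul
      (KineticTheory.continuous_maxwellianBeta β))).aestronglyMeasurable (Eventually.of_forall fun v => ?_)
  have hM := maxwellianBeta_pos hβ v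
  rw [Real.norm_of_nonneg (mul_nonneg (sq_nonneg _) (mul_nonneg (ha v).le hM.le)), div_pow]
  rw [show (v i) ^ 2 / collisionFrequency β v ^ 2 * (collisionFrequency β v * maxwellianBeta β v) =
      (v i) ^ 2 * maxwellianBeta β v / collisionFrequency β v by field_simp [(ha v).ne']]
  exact div_le_div_of_nonneg_left (mul_nonneg (sq_nonneg _) hM.le) ha₀ (hlow v).1

/-- `Fᵢ ∈ L²(a_β M_β)`. [folklore] -/
def coordRhs : Lp ℝ 2 (energyMeasure (d := d) β) := (memLp_coord_div hd hβ i).toLp _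

/-- `∫ vᵢ M_β(v) dv = 0` (oddness). [folklore] -/
theorem integral_coord_mul_maxwellianBeta : ∫ v : EuclideanSpace ℝ d, v i * maxwellianBeta β v = 0 := by
  have h := integral_neg_eq_self (fun v : EuclideanSpace ℝ d => v i * maxwellianBeta β v) volume
  simp only [maxwellianBeta_neg, PiLp.neg_apply, neg_mul, integral_neg] at h
  linarith

/-- **`Fᵢ ⊥ 1`**: `⟪1, Fᵢ⟫ = ∫ vᵢ M_β = 0`. [folklore] -/
theorem inner_constOne_coordRhs : ⟪constOne hβ, coordRhs hd hβ i⟫_ℝ = 0 := by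
  obtain ⟨a₀, ha₀, c, hc, hlow⟩ := exists_collisionFrequency_lowerBound (d := d) hd hβ
  rw [inner_constOne_left hd hβ]
  have h : ∫ v, rep (coordRhs hd hβ i) v * (collisionFrequency β v * maxwellianBeta β v) =
      ∫ v : EuclideanSpace ℝ d, v i * maxwellianBeta β v := by
    refine integral_congr_ae ?_
    filter_upwards [rep_toLp_ae_eq hd hβ (memLp_coord_div hd hβ i)] with v hv
    rw [coordRhs, hv]
    field_simp [(ha₀.trans_le (hlow v).1).ne']
  rw [h, integral_coord_mul_maxwellianBeta]

/-- **There is `gᵢ ∈ L²(a_β M_β)` with `gᵢ - T gᵢ = Fᵢ`.** [folklore] -/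
theorem exists_sub_gainOp_eq_coordRhs :
    ∃ g : Lp ℝ 2 (energyMeasure (d := d) β), g - gainOp hd hβ g = coordRhs hd hβ i :=
  exists_sub_gainOp_eq hd hβ _ (inner_constOne_coordRhs hd hβ i)

/-! ### From the weak equation to `a_β g - K g = vᵢ` a.e. -/

include hd hβ in
/-- `K g · M_β` is integrable for `g` of finite energy (absolute convergence,
`TaggedSphereCarleman`). [folklore] -/
theorem integrable_carlemanGain_mul_maxwellianBeta {g : EuclideanSpace ℝ d → ℝ} (hg : FiniteEnergy β g) :
    Integrable fun v => carlemanGain β g v * maxwellianBeta β v := by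
  have hmeas : StronglyMeasurable fun v => carlemanGain β g v := by
    refine StronglyMeasurable.integral_prod_right' (f := fun z : EuclideanSpace ℝ d × EuclideanSpace ℝ d =>
      carlemanKernel β z.1 z.2 * g (z.1 + z.2)) ?_
    exact ((measurable_carlemanKernel_prod β).mul (hg.measurable.comp measurable_add)).stronglyMeasurable
  refine ⟨(hmeas.measurable.mul (KineticTheory.measurable_maxwellianBeta β)).aestronglyMeasurable, ?_⟩
  have hfin := lintegral_lintegral_maxwellianBeta_mul_carlemanKernel_mul_enorm_lt_top hd hβ hg.measurable hg.integrable
  refine lt_of_le_of_lt (lintegral_mono fun v => ?_) hfin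
  rw [enorm_mul, Real.enorm_of_nonneg (maxwellianBeta_pos hβ v).le, mul_comm, carlemanGain]
  calc ENNReal.ofReal (maxwellianBeta β v) * ‖∫ u, carlemanKernel β v u * g (v + u)‖ₑ
      ≤ ENNReal.ofReal (maxwellianBeta β v) * ∫⁻ u, ‖carlemanKernel β v u * g (v + u)‖ₑ :=
        mul_le_mul' le_rfl (enorm_integral_le_lintegral_enorm _)
    _ = ∫⁻ u, ENNReal.ofReal (maxwellianBeta β v * carlemanKernel β v u) * ‖g (v + u)‖ₑ := by
        have hm : Measurable fun u : EuclideanSpace ℝ d => ‖carlemanKernel β v u * g (v + u)‖ₑ :=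
          ((measurable_carlemanKernel_right β v).mul (hg.measurable.comp (measurable_const_add v))).enorm
        rw [← lintegral_const_mul _ hm]
        refine lintegral_congr fun u => ?_
        rw [enorm_mul, Real.enorm_of_nonneg (carlemanKernel_nonneg β v u),
          ENNReal.ofReal_mul (maxwellianBeta_pos hβ v).le, mul_assoc]

include hβ in
/-- `a_β g · M_β` is integrable for `g` of finite energy (`2|g| a ≤ g² a + a`). [folklore] -/
theorem integrable_collisionFrequency_mul_mul_maxwellianBeta {g : EuclideanSpace ℝ d → ℝ} (hg : FiniteEnergy β g) :
    Integrable fun v => collisionFrequency β v * g v * maxwellianBeta β v := by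
  refine ((hg.integrable.add (integrable_collisionFrequency_mul_maxwellianBeta hβ)).div_const 2 |>.mono'
    (((continuous_collisionFrequency hβ).measurable.mul hg.measurable).mul
      (KineticTheory.measurable_maxwellianBeta β)).aestronglyMeasurable (Eventually.of_forall fun v => ?_))
  have ha := TaggedLinearBoltzmannSeries.collisionFrequency_nonneg hβ v
  have hM := (maxwellianBeta_pos hβ v).le
  rw [Real.norm_eq_abs, abs_mul, abs_mul, abs_of_nonneg ha, abs_of_nonneg hM]
  simp only [Pi.add_apply]
  have : |g v| * 2 ≤ g v ^ 2 + 1 := by nlinarith [sq_nonneg (|g v| - 1), sq_abs (g v)]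
  rw [le_div_iff₀ two_pos]
  nlinarith [mul_nonneg ha hM, this]

include hβ in
/-- Indicators have finite energy. [folklore] -/
theorem finiteEnergy_indicator {S : Set (EuclideanSpace ℝ d)} (hS : MeasurableSet S) :
    FiniteEnergy β (S.indicator fun _ => (1 : ℝ)) := by
  refine ⟨measurable_const.indicator hS, ?_⟩
  refine (integrable_collisionFrequency_mul_maxwellianBeta hβ).mono' ?_ (Eventually.of_forall fun v => ?_)
  · exact ((((measurable_const.indicator hS).pow_const 2).mul (continuous_collisionFrequency hβ).measurable).mul
      (KineticTheory.measurable_maxwellianBeta β)).aestronglyMeasurable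
  · have ha := TaggedLinearBoltzmannSeries.collisionFrequency_nonneg hβ v
    have hM := (maxwellianBeta_pos hβ v).le
    rw [Real.norm_of_nonneg (mul_nonneg (mul_nonneg (sq_nonneg _) ha) hM)]
    by_cases hv : v ∈ S
    · simp [hv]
    · simp [hv, mul_nonneg ha hM]

include hβ in
/-- Indicators lie in `L²(a_β M_β)`. [folklore] -/
theorem memLp_indicator_energyMeasure {S : Set (EuclideanSpace ℝ d)} (hS : MeasurableSet S) :
    MemLp (S.indicator fun _ => (1 : ℝ)) 2 (energyMeasure (d := d) β) := by
  haveI := isFiniteMeasure_energyMeasure (d := d) hβ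
  refine MemLp.of_bound ((measurable_const.indicator hS).aestronglyMeasurable) 1
    (Eventually.of_forall fun v => ?_)
  by_cases hv : v ∈ S <;> simp [hv]

/-- **Regularity transfer**: if `g - T g = F` in `L²(a_β M_β)` (with `a_β F M_β` integrable) then
`a_β g - K g = a_β F` a.e. (test the weak equation against indicators; `(a_β g - K g - a_β F) M_β`
is integrable, so it vanishes a.e.). [folklore] -/
theorem ae_sub_carlemanGain_eq_of {F : EuclideanSpace ℝ d → ℝ} (hF : MemLp F 2 (energyMeasure (d := d) β))
    (hFi : Integrable fun v => collisionFrequency β v * F v * maxwellianBeta β v)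
    {g : Lp ℝ 2 (energyMeasure (d := d) β)} (h : g - gainOp hd hβ g = hF.toLp F) :
    ∀ᵐ v ∂(volume : Measure (EuclideanSpace ℝ d)),
      collisionFrequency β v * rep g v - carlemanGain β (rep g) v = collisionFrequency β v * F v := by
  obtain ⟨a₀, ha₀, c, hc, hlow⟩ := exists_collisionFrequency_lowerBound (d := d) hd hβ
  have ha : ∀ w : EuclideanSpace ℝ d, 0 < collisionFrequency β w := fun w => ha₀.trans_le (hlow w).1
  have hg := finiteEnergy_rep hβ g
  set Ψ : EuclideanSpace ℝ d → ℝ := fun v =>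
    (collisionFrequency β v * rep g v - carlemanGain β (rep g) v - collisionFrequency β v * F v) *
      maxwellianBeta β v with hΨ
  have h1 := integrable_collisionFrequency_mul_mul_maxwellianBeta hβ hg
  have h2 := integrable_carlemanGain_mul_maxwellianBeta hd hβ hg
  have h3 := hFi
  have hΨint : Integrable Ψ :=
    ((h1.sub h2).sub h3).congr (Eventually.of_forall fun v => by simp only [hΨ, Pi.sub_apply]; ring)
  -- `∫_S Ψ = 0` for every measurable `S`
  have hzero : ∀ S : Set (EuclideanSpace ℝ d), MeasurableSet S → volume S < ∞ → ∫ v in S, Ψ v = 0 := by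
    intro S hS _
    have hmem := memLp_indicator_energyMeasure (d := d) hβ hS
    set hS' : Lp ℝ 2 (energyMeasure (d := d) β) := hmem.toLp _ with hhS
    have hrep : rep hS' =ᵐ[volume] S.indicator fun _ => (1 : ℝ) := rep_toLp_ae_eq hd hβ hmem
    have hind := finiteEnergy_indicator (d := d) hβ hS
    have heq := congrArg (fun x => ⟪x, hS'⟫_ℝ) h
    simp only [inner_sub_left] at heq
    have hbd : ∀ᵐ v ∂(volume : Measure (EuclideanSpace ℝ d)), ‖S.indicator (fun _ => (1 : ℝ)) v‖ ≤ 1 :=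
      Eventually.of_forall fun v => by by_cases hv : v ∈ S <;> simp [hv]
    have hmi : AEStronglyMeasurable (S.indicator fun _ => (1 : ℝ)) (volume : Measure (EuclideanSpace ℝ d)) :=
      (measurable_const.indicator hS).aestronglyMeasurable
    -- the three inner products
    have e1 : ⟪g, hS'⟫_ℝ = ∫ v, S.indicator (fun _ => (1 : ℝ)) v *
        (collisionFrequency β v * rep g v * maxwellianBeta β v) := by
      rw [inner_eq_integral_rep hβ]
      refine integral_congr_ae ?_
      filter_upwards [hrep] with v hv
      rw [hv]; ring
    have e2 : ⟪gainOp hd hβ g, hS'⟫_ℝ = ∫ v, S.indicator (fun _ => (1 : ℝ)) v *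
        (carlemanGain β (rep g) v * maxwellianBeta β v) := by
      rw [inner_gainOp, ← truncForm_one, truncForm_congr_ae β _ EventuallyEq.rfl hrep, truncForm_one,
        carlemanForm_eq_integral_carlemanGain hd hβ hg.measurable hg.integrable hind.measurable hind.integrable]
      refine integral_congr_ae (Eventually.of_forall fun v => ?_)
      ring
    have e3 : ⟪hF.toLp F, hS'⟫_ℝ = ∫ v, S.indicator (fun _ => (1 : ℝ)) v *
        (collisionFrequency β v * F v * maxwellianBeta β v) := by
      rw [inner_eq_integral_rep hβ]
      refine integral_congr_ae ?_
      filter_upwards [hrep, rep_toLp_ae_eq hd hβ hF] with v hv hv'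
      rw [hv, hv']
      ring
    rw [e1, e2, e3] at heq
    have i1 := h1.bdd_mul (c := 1) hmi hbd
    have i2 := h2.bdd_mul (c := 1) hmi hbd
    have i3 := h3.bdd_mul (c := 1) hmi hbd
    rw [← integral_indicator hS]
    have hΨS : S.indicator Ψ = fun v =>
        S.indicator (fun _ => (1 : ℝ)) v * (collisionFrequency β v * rep g v * maxwellianBeta β v) -
        S.indicator (fun _ => (1 : ℝ)) v * (carlemanGain β (rep g) v * maxwellianBeta β v) -
        S.indicator (fun _ => (1 : ℝ)) v * (collisionFrequency β v * F v * maxwellianBeta β v) := by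
      funext v
      by_cases hv : v ∈ S
      · simp only [indicator_of_mem hv, hΨ, one_mul]
        ring
      · simp only [indicator_of_notMem hv, zero_mul, sub_zero]
    have i12 : Integrable (fun v =>
        S.indicator (fun _ => (1 : ℝ)) v * (collisionFrequency β v * rep g v * maxwellianBeta β v) -
        S.indicator (fun _ => (1 : ℝ)) v * (carlemanGain β (rep g) v * maxwellianBeta β v)) := i1.sub i2
    simp only [hΨS]
    rw [integral_sub i12 i3, integral_sub i1 i2]
    linarith [heq]
  have hae := hΨint.ae_eq_zero_of_forall_setIntegral_eq_zero hzero
  filter_upwards [hae] with v hv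
  simp only [hΨ, Pi.zero_apply, mul_eq_zero] at hv
  rcases hv with hv | hv
  · linarith
  · exact absurd hv (maxwellianBeta_pos hβ v).ne'

/-- **`L g = a_β F` a.e.** for a solution of `g - T g = F` (`L = a_β - K⁺` and `K⁺ = K` where the
Carleman integral converges, which is a.e. for finite energy). [folklore] -/
theorem ae_linearBoltzmannOp_eq_of {F : EuclideanSpace ℝ d → ℝ} (hF : MemLp F 2 (energyMeasure (d := d) β))
    (hFi : Integrable fun v => collisionFrequency β v * F v * maxwellianBeta β v)
    {g : Lp ℝ 2 (energyMeasure (d := d) β)} (h : g - gainOp hd hβ g = hF.toLp F) :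
    ∀ᵐ v ∂(volume : Measure (EuclideanSpace ℝ d)),
      linearBoltzmannOp β (rep g) v = collisionFrequency β v * F v := by
  have hg := finiteEnergy_rep hβ g
  filter_upwards [ae_sub_carlemanGain_eq_of hd hβ hF hFi h,
    ae_integrable_carlemanKernel_mul hd hβ hg.measurable hg.integrable] with v hv hint
  rw [linearBoltzmannOp_eq_sub hd hβ hg.measurable v hint,
    linearBoltzmannGain_eq_carlemanGain hd hβ hg.measurable v hint]
  exact hv

include hβ in
/-- `vᵢ M_β` is integrable. [folklore] -/
theorem integrable_coord_mul_maxwellianBeta :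
    Integrable fun v : EuclideanSpace ℝ d => v i * maxwellianBeta β v := by
  have h1m := KineticTheory.integrable_pow_norm_mul_maxwellianBeta (d := d) hβ 1
  simp only [pow_one] at h1m
  refine h1m.mono' (((EuclideanSpace.proj (𝕜 := ℝ) i).continuous.measurable.mul
    (KineticTheory.measurable_maxwellianBeta β)).aestronglyMeasurable) (Eventually.of_forall fun v => ?_)
  rw [Real.norm_eq_abs, abs_mul, abs_of_nonneg (maxwellianBeta_pos hβ v).le]
  refine mul_le_mul_of_nonneg_right ?_ (maxwellianBeta_pos hβ v).le
  have hsq := sq_apply_le_norm_sq v i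
  exact abs_le.2 (abs_le_of_sq_le_sq' hsq (norm_nonneg _))

/-- **`L gᵢ = vᵢ` a.e.** for a solution of `gᵢ - T gᵢ = Fᵢ = vᵢ / a_β`. [folklore] -/
theorem ae_linearBoltzmannOp_rep_eq {g : Lp ℝ 2 (energyMeasure (d := d) β)}
    (h : g - gainOp hd hβ g = coordRhs hd hβ i) :
    ∀ᵐ v ∂(volume : Measure (EuclideanSpace ℝ d)), linearBoltzmannOp β (rep g) v = v i := by
  obtain ⟨a₀, ha₀, c, hc, hlow⟩ := exists_collisionFrequency_lowerBound (d := d) hd hβ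
  have ha : ∀ w : EuclideanSpace ℝ d, 0 < collisionFrequency β w := fun w => ha₀.trans_le (hlow w).1
  have hFi : Integrable fun v : EuclideanSpace ℝ d =>
      collisionFrequency β v * (v i / collisionFrequency β v) * maxwellianBeta β v :=
    (integrable_coord_mul_maxwellianBeta hβ i).congr (Eventually.of_forall fun v => by
      field_simp [(ha v).ne'])
  filter_upwards [ae_linearBoltzmannOp_eq_of hd hβ (memLp_coord_div hd hβ i) hFi h] with v hv
  rw [hv]
  field_simp [(ha v).ne']

end Solve

/-! ## Centring, assembly of the vector corrector, uniqueness -/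

section Assembly

variable (hd : 2 ≤ Fintype.card d) (hβ : 0 < β)

include hd hβ in
/-- `g M_β` is integrable for `g` of finite energy. [folklore] -/
theorem integrable_mul_maxwellianBeta_of_finiteEnergy {g : EuclideanSpace ℝ d → ℝ} (hg : FiniteEnergy β g) :
    Integrable fun v => g v * maxwellianBeta β v := by
  obtain ⟨a₀, ha₀, c, hc, hlow⟩ := exists_collisionFrequency_lowerBound (d := d) hd hβ
  refine ((integrable_collisionFrequency_mul_mul_maxwellianBeta hβ hg).norm.div_const a₀).mono'
    ((hg.measurable.mul (KineticTheory.measurable_maxwellianBeta β)).aestronglyMeasurable)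
    (Eventually.of_forall fun v => ?_)
  have ha := (hlow v).1
  have hM := (maxwellianBeta_pos hβ v).le
  rw [Real.norm_eq_abs, Real.norm_eq_abs, abs_mul, abs_of_nonneg hM, le_div_iff₀ ha₀, abs_mul, abs_mul,
    abs_of_nonneg (ha₀.le.trans ha), abs_of_nonneg hM]
  nlinarith [mul_nonneg (abs_nonneg (g v)) hM, ha]

include hd hβ in
/-- **Centring preserves the equation**: if `L g = R` a.e. then `L (g - c) = R` a.e. (`L c = 0`,
linearity where the Carleman integral converges). [folklore] -/
theorem ae_linearBoltzmannOp_sub_const_eq {g : EuclideanSpace ℝ d → ℝ} (hg : FiniteEnergy β g)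
    {R : EuclideanSpace ℝ d → ℝ}
    (h : ∀ᵐ v ∂(volume : Measure (EuclideanSpace ℝ d)), linearBoltzmannOp β g v = R v) (c : ℝ) :
    ∀ᵐ v ∂(volume : Measure (EuclideanSpace ℝ d)), linearBoltzmannOp β (fun w => g w - c) v = R v := by
  have hgc : FiniteEnergy β (fun w => g w - c) := by
    refine ⟨hg.measurable.sub measurable_const, ?_⟩
    have h1 := hg.integrable
    have h2 := (finiteEnergy_const (d := d) hβ c).integrable
    have h3 := integrable_collisionFrequency_mul_mul_maxwellianBeta hβ hg
    exact ((h1.add h2).sub (h3.const_mul (2 * c))).congr (Eventually.of_forall fun v => by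
      simp only [Pi.add_apply, Pi.sub_apply]; ring)
  filter_upwards [h, ae_integrable_carlemanKernel_mul hd hβ hg.measurable hg.integrable,
    ae_integrable_carlemanKernel_mul hd hβ hgc.measurable hgc.integrable] with v hv hint hint'
  rw [linearBoltzmannOp_eq_sub hd hβ hgc.measurable v hint',
    linearBoltzmannGain_eq_carlemanGain hd hβ hgc.measurable v hint']
  rw [linearBoltzmannOp_eq_sub hd hβ hg.measurable v hint,
    linearBoltzmannGain_eq_carlemanGain hd hβ hg.measurable v hint] at hv
  have hK : carlemanGain β (fun w => g w - c) v = carlemanGain β g v - c * collisionFrequency β v := by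
    rw [carlemanGain, carlemanGain, ← integral_carlemanKernel hd hβ v, ← integral_const_mul,
      ← integral_sub hint ((integrable_carlemanKernel hd hβ v).const_mul c)]
    refine integral_congr_ae (Eventually.of_forall fun u => ?_)
    ring
  rw [hK]
  linarith

/-- Finite energy of `g - c`. [folklore] -/
theorem FiniteEnergy.sub_const {g : EuclideanSpace ℝ d → ℝ} (hg : FiniteEnergy β g) (hβ : 0 < β) (c : ℝ) :
    FiniteEnergy β (fun w => g w - c) := by
  refine ⟨hg.measurable.sub measurable_const, ?_⟩
  have h1 := hg.integrable
  have h2 := (finiteEnergy_const (d := d) hβ c).integrable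
  have h3 := integrable_collisionFrequency_mul_mul_maxwellianBeta hβ hg
  exact ((h1.add h2).sub (h3.const_mul (2 * c))).congr (Eventually.of_forall fun v => by
    simp only [Pi.add_apply, Pi.sub_apply]; ring)

include hd hβ in
/-- **Centred solutions of `L g = a_β F`**: for `F ∈ L²(a_β M_β)` with `a_β F M_β` integrable and
`⟪1, F⟫ = ∫ a_β F M_β = 0` there is a centred `g` of finite energy with `L g = a_β F` a.e. (BGSR
Lemma 6.1: "`L` is invertible on `{g ∈ L²(a_β M_β), ∫ g M_β = 0}`", for right-hand sides
`a_β F ⊥ 1`). [cite: BodineauGallagherSaintRaymondInvent2016, Lemma 6.1] -/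
theorem exists_centred_solution {F : EuclideanSpace ℝ d → ℝ} (hF : MemLp F 2 (energyMeasure (d := d) β))
    (hFi : Integrable fun v => collisionFrequency β v * F v * maxwellianBeta β v)
    (h1 : ⟪constOne hβ, hF.toLp F⟫_ℝ = 0) :
    ∃ g : EuclideanSpace ℝ d → ℝ, FiniteEnergy β g ∧ ∫ v, g v * maxwellianBeta β v = 0 ∧
      ∀ᵐ v ∂(volume : Measure (EuclideanSpace ℝ d)),
        linearBoltzmannOp β g v = collisionFrequency β v * F v := by
  obtain ⟨G, hG⟩ := exists_sub_gainOp_eq hd hβ _ h1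
  have hg := finiteEnergy_rep hβ G
  set c : ℝ := ∫ v, rep G v * maxwellianBeta β v with hc
  refine ⟨fun w => rep G w - c, hg.sub_const hβ c, ?_, ae_linearBoltzmannOp_sub_const_eq hd hβ hg
    (ae_linearBoltzmannOp_eq_of hd hβ hF hFi hG) c⟩
  simp_rw [sub_mul]
  rw [integral_sub (integrable_mul_maxwellianBeta_of_finiteEnergy hd hβ hg)
    ((KineticTheory.integrable_maxwellianBeta hβ).const_mul c), integral_const_mul,
    KineticTheory.integral_maxwellianBeta hβ, ← hc, mul_one, sub_self]

include hd hβ in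
/-- **A centred scalar corrector for each coordinate**: `gᵢ ∈ L²(a_β M_β)`, `∫ gᵢ M_β = 0`,
`L gᵢ = vᵢ` a.e. [folklore] -/
theorem exists_centred_corrector (i : d) :
    ∃ g : EuclideanSpace ℝ d → ℝ, FiniteEnergy β g ∧ ∫ v, g v * maxwellianBeta β v = 0 ∧
      ∀ᵐ v ∂(volume : Measure (EuclideanSpace ℝ d)), linearBoltzmannOp β g v = v i := by
  obtain ⟨a₀, ha₀, c, hc, hlow⟩ := exists_collisionFrequency_lowerBound (d := d) hd hβ
  have ha : ∀ w : EuclideanSpace ℝ d, 0 < collisionFrequency β w := fun w => ha₀.trans_le (hlow w).1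
  have hFi : Integrable fun v : EuclideanSpace ℝ d =>
      collisionFrequency β v * (v i / collisionFrequency β v) * maxwellianBeta β v :=
    (integrable_coord_mul_maxwellianBeta hβ i).congr (Eventually.of_forall fun v => by
      field_simp [(ha v).ne'])
  obtain ⟨g, hg, hgc, hL⟩ := exists_centred_solution hd hβ (memLp_coord_div hd hβ i) hFi
    (inner_constOne_coordRhs hd hβ i)
  refine ⟨g, hg, hgc, ?_⟩
  filter_upwards [hL] with v hv
  rw [hv]
  field_simp [(ha v).ne']

include hd hβ in
/-- Components of finite energy make `M_β • f` integrable (`|x| ≤ (|x|² + 1)/2`, `M_β ≤ a_β M_β / a₀`).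
[folklore] -/
theorem integrable_maxwellianBeta_smul_of_finiteEnergy {f : EuclideanSpace ℝ d → EuclideanSpace ℝ d} (hfm : Measurable f)
    (hfi : ∀ i, FiniteEnergy β (fun v => f v i)) :
    Integrable fun v => maxwellianBeta β v • f v := by
  obtain ⟨a₀, ha₀, c, hc, hlow⟩ := exists_collisionFrequency_lowerBound (d := d) hd hβ
  have hsq : ∀ i, Integrable fun v => f v i ^ 2 * maxwellianBeta β v := fun i => by
    refine ((hfi i).integrable.div_const a₀).mono' ((((hfi i).measurable.pow_const 2).mul
      (KineticTheory.measurable_maxwellianBeta β)).aestronglyMeasurable) (Eventually.of_forall fun v => ?_)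
    have hM := (maxwellianBeta_pos hβ v).le
    rw [Real.norm_of_nonneg (mul_nonneg (sq_nonneg _) hM), le_div_iff₀ ha₀]
    calc f v i ^ 2 * maxwellianBeta β v * a₀ = a₀ * (f v i ^ 2 * maxwellianBeta β v) := by ring
      _ ≤ collisionFrequency β v * (f v i ^ 2 * maxwellianBeta β v) :=
          mul_le_mul_of_nonneg_right (hlow v).1 (mul_nonneg (sq_nonneg _) hM)
      _ = f v i ^ 2 * collisionFrequency β v * maxwellianBeta β v := by ring
  have hdom : Integrable fun v => ((∑ i, f v i ^ 2 * maxwellianBeta β v) + maxwellianBeta β v) / 2 :=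
    ((integrable_finsetSum _ fun i _ => hsq i).add (KineticTheory.integrable_maxwellianBeta hβ)).div_const 2
  refine hdom.mono' (((KineticTheory.measurable_maxwellianBeta β).smul hfm).aestronglyMeasurable)
    (Eventually.of_forall fun v => ?_)
  have hM := (maxwellianBeta_pos hβ v).le
  rw [norm_smul, Real.norm_of_nonneg hM]
  have hn : ‖f v‖ ^ 2 = ∑ i, f v i ^ 2 := by
    rw [EuclideanSpace.norm_sq_eq]
    exact Finset.sum_congr rfl fun i _ => by rw [Real.norm_eq_abs, sq_abs]
  have h1 : maxwellianBeta β v * ‖f v‖ ≤ (‖f v‖ ^ 2 * maxwellianBeta β v + maxwellianBeta β v) / 2 := by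
    nlinarith [sq_nonneg (‖f v‖ - 1), norm_nonneg (f v), hM]
  rw [hn, Finset.sum_mul] at h1
  exact h1

include hd hβ in
/-- A centred vector field is centred componentwise: `∫ M_β • f = 0 ⇒ ∫ fᵢ M_β = 0`. [folklore] -/
theorem integral_apply_mul_maxwellianBeta_eq_zero {f : EuclideanSpace ℝ d → EuclideanSpace ℝ d}
    (hfm : Measurable f) (hfi : ∀ i, FiniteEnergy β (fun v => f v i))
    (hfc : ∫ v, maxwellianBeta β v • f v = 0) (i : d) :
    ∫ v, f v i * maxwellianBeta β v = 0 := by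
  classical
  have h := integral_inner (𝕜 := ℝ) (integrable_maxwellianBeta_smul_of_finiteEnergy hd hβ hfm hfi)
    (EuclideanSpace.single i (1 : ℝ))
  rw [hfc, inner_zero_right] at h
  rw [← h]
  refine integral_congr_ae (Eventually.of_forall fun v => ?_)
  simp only
  rw [inner_smul_right, EuclideanSpace.inner_single_left]
  simp [mul_comm]

include hd hβ in
/-- **Existence of the diffusion corrector** (BGSR (6.5): `L b = v`, `∫ b M_β = 0`,
`b ∈ L²(a_β M_β)`). [cite: BodineauGallagherSaintRaymondInvent2016, Lemma 6.1 and (6.5)] -/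
theorem exists_isDiffusionCorrector : ∃ b : EuclideanSpace ℝ d → EuclideanSpace ℝ d, IsDiffusionCorrector β b := by
  choose g hg hcent hL using exists_centred_corrector hd hβ
  set b : EuclideanSpace ℝ d → EuclideanSpace ℝ d := fun v => WithLp.toLp 2 fun i => g i v with hb
  have hbi : ∀ v i, b v i = g i v := fun v i => rfl
  have hbm : Measurable b :=
    (PiLp.continuous_toLp 2 (fun _ : d => ℝ)).measurable.comp (measurable_pi_lambda _ fun i => (hg i).measurable)
  have hfe : ∀ i, FiniteEnergy β (fun v => b v i) := fun i => by simpa only [hbi] using hg i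
  refine ⟨b, hbm, ?_, ?_, ?_⟩
  · -- finite energy of `|b|² = ∑ bᵢ²`
    have hsum : (fun v => ‖b v‖ ^ 2 * collisionFrequency β v * maxwellianBeta β v) =
        fun v => ∑ i, g i v ^ 2 * collisionFrequency β v * maxwellianBeta β v := by
      funext v
      rw [EuclideanSpace.norm_sq_eq, Finset.sum_mul, Finset.sum_mul]
      refine Finset.sum_congr rfl fun i _ => ?_
      rw [hbi, Real.norm_eq_abs, sq_abs]
    rw [hsum]
    exact integrable_finsetSum _ fun i _ => (hg i).integrable
  · -- centred
    refine integral_eq_zero_of_forall_integral_inner_eq_zero (𝕜 := ℝ) _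
      (integrable_maxwellianBeta_smul_of_finiteEnergy hd hβ hbm hfe)
      fun c => ?_
    have hint : ∀ i, Integrable fun v => c i * (g i v * maxwellianBeta β v) := fun i =>
      (integrable_mul_maxwellianBeta_of_finiteEnergy hd hβ (hg i)).const_mul _
    calc ∫ v, ⟪c, maxwellianBeta β v • b v⟫_ℝ = ∫ v, ∑ i, c i * (g i v * maxwellianBeta β v) := by
          refine integral_congr_ae (Eventually.of_forall fun v => ?_)
          simp only
          rw [inner_smul_right, inner_eq_sum_apply, Finset.mul_sum]
          refine Finset.sum_congr rfl fun i _ => ?_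
          rw [hbi]; ring
      _ = ∑ i, ∫ v, c i * (g i v * maxwellianBeta β v) := integral_finsetSum _ fun i _ => hint i
      _ = 0 := Finset.sum_eq_zero fun i _ => by rw [integral_const_mul, hcent i, mul_zero]
  · -- the equation, all coordinates at once
    have hall : ∀ i, ∀ᵐ v ∂(volume : Measure (EuclideanSpace ℝ d)),
        linearBoltzmannOp β (fun w => b w i) v = v i := fun i => by
      simpa only [hbi] using hL i
    exact ae_all_iff.2 hall

include hd hβ in
/-- **Uniqueness of the diffusion corrector**: two correctors agree a.e. (componentwise, their
difference is a centred element of `ker L = ℝ 1`). [cite: BodineauGallagherSaintRaymondInvent2016, Lemma 6.1] -/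
theorem isDiffusionCorrector_unique {b b' : EuclideanSpace ℝ d → EuclideanSpace ℝ d}
    (hb : IsDiffusionCorrector β b) (hb' : IsDiffusionCorrector β b') : b =ᵐ[volume] b' := by
  obtain ⟨hbm, hbi, hbc, hbL⟩ := id hb
  obtain ⟨hbm', hbi', hbc', hbL'⟩ := id hb'
  have hfe : ∀ i, FiniteEnergy β (fun v => b v i) := fun i =>
    ⟨(EuclideanSpace.proj (𝕜 := ℝ) i).continuous.measurable.comp hbm, hb.integrable_sq_apply hβ i⟩
  have hfe' : ∀ i, FiniteEnergy β (fun v => b' v i) := fun i =>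
    ⟨(EuclideanSpace.proj (𝕜 := ℝ) i).continuous.measurable.comp hbm', hb'.integrable_sq_apply hβ i⟩
  -- componentwise
  suffices hcomp : ∀ i : d, (fun v => b v i) =ᵐ[volume] fun v => b' v i by
    have hall := ae_all_iff.2 hcomp
    filter_upwards [hall] with v hv
    exact PiLp.ext fun i => hv i
  intro i
  have hgi := hfe i
  have hgi' := hfe' i
  -- the difference `g = bᵢ - b'ᵢ`
  set g : EuclideanSpace ℝ d → ℝ := fun v => b v i - b' v i with hg_def
  have hg : FiniteEnergy β g := by
    refine ⟨hgi.measurable.sub hgi'.measurable, ?_⟩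
    refine (((hgi.integrable.add hgi'.integrable).const_mul 2).mono'
      ((((hgi.measurable.sub hgi'.measurable).pow_const 2).mul
        (continuous_collisionFrequency hβ).measurable).mul
        (KineticTheory.measurable_maxwellianBeta β)).aestronglyMeasurable (Eventually.of_forall fun v => ?_))
    have ha := TaggedLinearBoltzmannSeries.collisionFrequency_nonneg hβ v
    have hM := (maxwellianBeta_pos hβ v).le
    rw [Real.norm_of_nonneg (mul_nonneg (mul_nonneg (sq_nonneg _) ha) hM)]
    simp only [Pi.add_apply]
    have : (b v i - b' v i) ^ 2 ≤ 2 * (b v i ^ 2 + b' v i ^ 2) := by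
      nlinarith [sq_nonneg (b v i + b' v i)]
    calc (b v i - b' v i) ^ 2 * collisionFrequency β v * maxwellianBeta β v
        ≤ 2 * (b v i ^ 2 + b' v i ^ 2) * collisionFrequency β v * maxwellianBeta β v := by gcongr
      _ = 2 * (b v i ^ 2 * collisionFrequency β v * maxwellianBeta β v +
          b' v i ^ 2 * collisionFrequency β v * maxwellianBeta β v) := by ring
  -- `a g = K g` a.e.
  have hLg : ∀ᵐ v ∂(volume : Measure (EuclideanSpace ℝ d)),
      collisionFrequency β v * g v - carlemanGain β g v = 0 := by
    filter_upwards [hbL, hbL', ae_integrable_carlemanKernel_mul hd hβ hgi.measurable hgi.integrable,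
      ae_integrable_carlemanKernel_mul hd hβ hgi'.measurable hgi'.integrable] with v hv hv' hint hint'
    have e1 := hv i
    have e2 := hv' i
    rw [linearBoltzmannOp_eq_sub hd hβ hgi.measurable v hint,
      linearBoltzmannGain_eq_carlemanGain hd hβ hgi.measurable v hint] at e1
    rw [linearBoltzmannOp_eq_sub hd hβ hgi'.measurable v hint',
      linearBoltzmannGain_eq_carlemanGain hd hβ hgi'.measurable v hint'] at e2
    have hK : carlemanGain β g v =
        carlemanGain β (fun w => b w i) v - carlemanGain β (fun w => b' w i) v := by
      rw [carlemanGain, carlemanGain, carlemanGain, ← integral_sub hint hint']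
      refine integral_congr_ae (Eventually.of_forall fun u => ?_)
      simp only [hg_def]; ring
    rw [hK]
    simp only [hg_def]
    linarith
  -- in `L²(a_β M_β)`: `T G = G`
  have hmem : MemLp g 2 (energyMeasure (d := d) β) := by
    rw [memLp_two_iff_integrable_sq (hg.measurable.aestronglyMeasurable), integrable_energyMeasure_iff hβ]
    exact hg.integrable.congr (Eventually.of_forall fun v => by ring)
  set G : Lp ℝ 2 (energyMeasure (d := d) β) := hmem.toLp g with hG
  have hrepG : rep G =ᵐ[volume] g := rep_toLp_ae_eq hd hβ hmem
  have hTG : gainOp hd hβ G = G := by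
    refine ext_inner_right ℝ fun h => ?_
    have hh := finiteEnergy_rep hβ h
    rw [inner_gainOp, ← truncForm_one, truncForm_congr_ae β _ hrepG EventuallyEq.rfl, truncForm_one,
      carlemanForm_eq_integral_carlemanGain hd hβ hg.measurable hg.integrable hh.measurable hh.integrable,
      inner_eq_integral_rep hβ]
    refine integral_congr_ae ?_
    filter_upwards [hLg, hrepG] with v hv hv'
    rw [hv']
    have : carlemanGain β g v = collisionFrequency β v * g v := by linarith
    rw [this]; ring
  obtain ⟨c, hc⟩ := exists_const_of_gainOp_apply_eq hd hβ hTG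
  -- `g = c` a.e., and `∫ g M_β = 0` forces `c = 0`
  have hgc : g =ᵐ[volume] fun _ => c := by
    filter_upwards [hc, hrepG] with v hv hv'; rw [← hv', hv]
  have hcent : ∫ v, g v * maxwellianBeta β v = 0 := by
    have h1 := integral_apply_mul_maxwellianBeta_eq_zero hd hβ hbm hfe hbc i
    have h2 := integral_apply_mul_maxwellianBeta_eq_zero hd hβ hbm' hfe' hbc' i
    simp only [hg_def, sub_mul]
    rw [integral_sub (integrable_mul_maxwellianBeta_of_finiteEnergy hd hβ hgi)
      (integrable_mul_maxwellianBeta_of_finiteEnergy hd hβ hgi'), h1, h2, sub_zero]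
  have hc0 : c = 0 := by
    have h := integral_congr_ae (μ := (volume : Measure (EuclideanSpace ℝ d)))
      (show (fun v => g v * maxwellianBeta β v) =ᵐ[volume] fun v => c * maxwellianBeta β v by
        filter_upwards [hgc] with v hv; rw [hv])
    rw [hcent, integral_const_mul, KineticTheory.integral_maxwellianBeta hβ, mul_one] at h
    exact h.symm
  rw [hc0] at hgc
  filter_upwards [hgc] with v hv
  have : b v i - b' v i = 0 := hv
  linarith

/-! ## The second corrector `D` of BGSR (6.7) -/

include hd hβ in
/-- `g² M_β` is integrable for `g` of finite energy (`M_β ≤ a_β M_β / a₀`). [folklore] -/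
theorem integrable_sq_mul_maxwellianBeta_of_finiteEnergy {g : EuclideanSpace ℝ d → ℝ} (hg : FiniteEnergy β g) :
    Integrable fun v => g v ^ 2 * maxwellianBeta β v := by
  obtain ⟨a₀, ha₀, c, hc, hlow⟩ := exists_collisionFrequency_lowerBound (d := d) hd hβ
  refine (hg.integrable.div_const a₀).mono' (((hg.measurable.pow_const 2).mul
    (KineticTheory.measurable_maxwellianBeta β)).aestronglyMeasurable) (Eventually.of_forall fun v => ?_)
  have hM := (maxwellianBeta_pos hβ v).le
  rw [Real.norm_of_nonneg (mul_nonneg (sq_nonneg _) hM), le_div_iff₀ ha₀]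
  calc g v ^ 2 * maxwellianBeta β v * a₀ = a₀ * (g v ^ 2 * maxwellianBeta β v) := by ring
    _ ≤ collisionFrequency β v * (g v ^ 2 * maxwellianBeta β v) :=
        mul_le_mul_of_nonneg_right (hlow v).1 (mul_nonneg (sq_nonneg _) hM)
    _ = g v ^ 2 * collisionFrequency β v * maxwellianBeta β v := by ring

include hd hβ in
/-- **BGSR (6.7): the second corrector exists.** For a diffusion corrector `b` and coordinates
`k, l` there is a centred `D_{kl} ∈ L²(a_β M_β)` with
`L D_{kl} = v_k b_l(v) - ∫ w_k b_l(w) M_β(w) dw` a.e. — the entries of the matrix `D` defined by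
`L D(v) = v ⊗ b(v) - ∫ v ⊗ b(v) M_β(v) dv`, `∫ D_{kl} M_β = 0`. The right-hand side is `a_β F`
with `F = (v_k b_l - c₀)/a_β ∈ L²(a_β M_β)` because `v_k² ≤ |v|² ≤ a_β²/c²`
(`a_β(v) ≥ c |v|`), and it is orthogonal to `1` by the choice of the constant `c₀`.
[cite: BodineauGallagherSaintRaymondInvent2016, (6.7)] -/
theorem exists_secondCorrector {b : EuclideanSpace ℝ d → EuclideanSpace ℝ d} (hb : IsDiffusionCorrector β b)
    (k l : d) :
    ∃ D : EuclideanSpace ℝ d → ℝ, FiniteEnergy β D ∧ ∫ v, D v * maxwellianBeta β v = 0 ∧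
      ∀ᵐ v ∂(volume : Measure (EuclideanSpace ℝ d)), linearBoltzmannOp β D v =
        v k * b v l - ∫ w : EuclideanSpace ℝ d, w k * b w l * maxwellianBeta β w := by
  obtain ⟨a₀, ha₀, c, hc, hlow⟩ := exists_collisionFrequency_lowerBound (d := d) hd hβ
  have ha : ∀ w : EuclideanSpace ℝ d, 0 < collisionFrequency β w := fun w => ha₀.trans_le (hlow w).1
  obtain ⟨hbm, -, -, -⟩ := id hb
  have hbl : FiniteEnergy β (fun v => b v l) :=
    ⟨(EuclideanSpace.proj (𝕜 := ℝ) l).continuous.measurable.comp hbm, hb.integrable_sq_apply hβ l⟩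
  have hkm : Measurable fun v : EuclideanSpace ℝ d => v k := (EuclideanSpace.proj (𝕜 := ℝ) k).continuous.measurable
  have hM0 := KineticTheory.integrable_maxwellianBeta (d := d) hβ
  -- `v_k b_l M_β` is integrable (`2|xy| ≤ x² + y²`)
  have hprod : Integrable fun v : EuclideanSpace ℝ d => v k * b v l * maxwellianBeta β v := by
    refine (((integrable_sq_apply_mul_maxwellianBeta hβ k).add
      (integrable_sq_mul_maxwellianBeta_of_finiteEnergy hd hβ hbl)).div_const 2).mono'
      (((hkm.mul hbl.measurable).mul (KineticTheory.measurable_maxwellianBeta β)).aestronglyMeasurable)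
      (Eventually.of_forall fun v => ?_)
    have hM := (maxwellianBeta_pos hβ v).le
    rw [Real.norm_eq_abs, abs_mul, abs_of_nonneg hM, abs_mul]
    simp only [Pi.add_apply]
    have h2 : |v k| * |b v l| * 2 ≤ v k ^ 2 + b v l ^ 2 := by
      nlinarith [sq_nonneg (|v k| - |b v l|), sq_abs (v k), sq_abs (b v l), abs_nonneg (v k), abs_nonneg (b v l)]
    rw [le_div_iff₀ two_pos]
    nlinarith [h2, hM]
  set c₀ : ℝ := ∫ w : EuclideanSpace ℝ d, w k * b w l * maxwellianBeta β w with hc₀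
  set F : EuclideanSpace ℝ d → ℝ := fun v => (v k * b v l - c₀) / collisionFrequency β v with hF_def
  have hFm : Measurable F := ((hkm.mul hbl.measurable).sub measurable_const).div
    (continuous_collisionFrequency hβ).measurable
  have haF : ∀ v, collisionFrequency β v * F v = v k * b v l - c₀ := fun v => by
    simp only [hF_def]; field_simp [(ha v).ne']
  have hFi : Integrable fun v => collisionFrequency β v * F v * maxwellianBeta β v :=
    (hprod.sub (hM0.const_mul c₀)).congr (Eventually.of_forall fun v => by
      simp only [Pi.sub_apply]; rw [haF]; ring)
  -- `F ∈ L²(a_β M_β)`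
  have hF : MemLp F 2 (energyMeasure (d := d) β) := by
    rw [memLp_two_iff_integrable_sq hFm.aestronglyMeasurable, integrable_energyMeasure_iff hβ]
    refine ((hbl.integrable.const_mul (2 / c ^ 2)).add (hM0.const_mul (2 * c₀ ^ 2 / a₀))).mono'
      ((hFm.pow_const 2).mul (measurable_collisionFrequency_mul_maxwellianBeta hβ)).aestronglyMeasurable
      (Eventually.of_forall fun v => ?_)
    have hA := ha v
    have hMv := maxwellianBeta_pos hβ v
    rw [Real.norm_of_nonneg (mul_nonneg (sq_nonneg _) (mul_nonneg hA.le hMv.le))]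
    simp only [Pi.add_apply]
    have hx : v k ^ 2 ≤ collisionFrequency β v ^ 2 / c ^ 2 := by
      have h1 : v k ^ 2 ≤ ‖v‖ ^ 2 := sq_apply_le_norm_sq v k
      have h2 : ‖v‖ ≤ collisionFrequency β v / c := by
        rw [le_div_iff₀ hc, mul_comm]; exact (hlow v).2
      have h3 : ‖v‖ ^ 2 ≤ (collisionFrequency β v / c) ^ 2 := pow_le_pow_left₀ (norm_nonneg _) h2 2
      rw [div_pow] at h3
      exact h1.trans h3
    have hsq2 : (v k * b v l - c₀) ^ 2 ≤ 2 * (v k ^ 2 * b v l ^ 2) + 2 * c₀ ^ 2 := by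
      nlinarith [sq_nonneg (v k * b v l + c₀)]
    have hE : F v ^ 2 * (collisionFrequency β v * maxwellianBeta β v) =
        (v k * b v l - c₀) ^ 2 * (maxwellianBeta β v / collisionFrequency β v) := by
      simp only [hF_def]
      field_simp [hA.ne']
    rw [hE]
    calc (v k * b v l - c₀) ^ 2 * (maxwellianBeta β v / collisionFrequency β v)
        ≤ (2 * (v k ^ 2 * b v l ^ 2) + 2 * c₀ ^ 2) * (maxwellianBeta β v / collisionFrequency β v) :=
          mul_le_mul_of_nonneg_right hsq2 (div_nonneg hMv.le hA.le)
      _ = 2 * (v k ^ 2 * (b v l ^ 2 * maxwellianBeta β v / collisionFrequency β v)) +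
          2 * c₀ ^ 2 * (maxwellianBeta β v / collisionFrequency β v) := by ring
      _ ≤ 2 * (collisionFrequency β v ^ 2 / c ^ 2 * (b v l ^ 2 * maxwellianBeta β v / collisionFrequency β v)) +
          2 * c₀ ^ 2 * (maxwellianBeta β v / a₀) := by
          gcongr
          · exact (hlow v).1
      _ = 2 / c ^ 2 * (b v l ^ 2 * collisionFrequency β v * maxwellianBeta β v) +
          2 * c₀ ^ 2 / a₀ * maxwellianBeta β v := by
          field_simp
  -- `F ⊥ 1`
  have h1 : ⟪constOne hβ, hF.toLp F⟫_ℝ = 0 := by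
    rw [inner_constOne_left hd hβ]
    have e : ∫ v, rep (hF.toLp F) v * (collisionFrequency β v * maxwellianBeta β v) =
        ∫ v : EuclideanSpace ℝ d, (v k * b v l * maxwellianBeta β v - c₀ * maxwellianBeta β v) := by
      refine integral_congr_ae ?_
      filter_upwards [rep_toLp_ae_eq hd hβ hF] with v hv
      rw [hv, show F v * (collisionFrequency β v * maxwellianBeta β v) =
        (collisionFrequency β v * F v) * maxwellianBeta β v by ring, haF]
      ring
    rw [e, integral_sub hprod (hM0.const_mul c₀), integral_const_mul, KineticTheory.integral_maxwellianBeta hβ,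
      ← hc₀, mul_one, sub_self]
  obtain ⟨D, hD, hDc, hL⟩ := exists_centred_solution hd hβ hF hFi h1
  refine ⟨D, hD, hDc, ?_⟩
  filter_upwards [hL] with v hv
  rw [hv, haF]

/-- **BGSR Lemma 6.1 with (6.5), discharged**: for `d ≥ 2` and `β > 0` the diffusion corrector
`b = L⁻¹ v` (centred, in `L²(a_β M_β)`, `L bᵢ = vᵢ` a.e.) exists and is unique a.e.
[cite: BodineauGallagherSaintRaymondInvent2016, Lemma 6.1 and (6.5)] -/
theorem bgsr_exists_diffusionCorrector_holds : bgsr_exists_diffusionCorrector (d := d) := by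
  intro hd β hβ
  exact ⟨exists_isDiffusionCorrector hd hβ, fun b b' hb hb' => isDiffusionCorrector_unique hd hβ hb hb'⟩

end Assembly

end Literature.MathematicalPhysics.KineticTheory
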